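import Literature.Computability.QuantumComplexity.LightConeMachineAmp
import Literature.Computability.QuantumComplexity.LightConeDecision
import Literature.Computability.QuantumComplexity.ADHMachine
import Literature.Computability.Complexity.ListFoldBricks
import HarnessLib

/-!
# The light-cone simulator as an `FP` machine, II: labels, sparse states, lookup; the cone pass and the Hadamard count

Second machine file of the discharge of `Literature.Barriers.QuantumAdvantage.markovShi2008_cor15_anyOrder`
(Markov–Shi 2008, Cor. 1.5, decision form), continuing `LightConeMachineAmp.lean`. A label
`y : QReg N` is the bit list `List.ofFn y` (wire `0` first, as in `ADHMachine.lean`), an entry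
`(y, a)` of a sparse state is `⟨List.ofFn y, ampEnc a⟩`, a state is the coded list of its entries
(`encList`), and the gates are the codes `QGate.encode` of a description
(`false ⟨bin op, ⟨1ᵏ, ⟨bin i, ⟨bin j, ε⟩⟩⟩⟩`, shapes `ADH.encode_gateH/S/T/CNOT`):

* `itemEnc`, `stEnc` and their shape lemmas (`decNil_stEnc`, length bookkeeping);
* the label bricks `bitF u w` (the bit at the unary position `u`), `setF u w b` (writing a bit),
  parameterised by field functions, with their values on labels and their total lengths;
* **`lookupF`** — `⟨List.ofFn y, stEnc st⟩ ↦ ampEnc (lookup st y)` (`lookupF_stEnc`): a fold over the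
  entries (`Brick.foldFn`) carrying `⟨found-flag, value⟩`; `lookupF_mem_FP`, and the total bound
  `|lookupF w| ≤ |sndF w| + 20` on every string (`length_lookupF_le`);
* `sEnc`, `ccEnc` (codes of wire lists and gate lists), `revF` (reversing a coded list);
* **`conePassF`** — the backward light cone of wire `0` as a fold over the reversed code list with
  accumulator `⟨S, CC⟩` (`S` the wire numerals found so far, from `[bin 0]`; `CC` the kept codes,
  pushed, hence in circuit order): it computes `LightCone.coneL` (`conePassF_spec`), is in `FP`
  (`FoldGrowth 8`, no clipping);
* `hCountF` — the number of kept Hadamard gates in unary (`hCountF_ccEnc`).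

(The parallel function-table simulator keeps its labels as an explicit list and its amplitudes in
a table, `ConeSimModel.lean`/`ConeSimStep.lean`; the association-list layout here is the one of
`LightConeSim.lean`.)

## References

* S. Arora, B. Barak, *Computational Complexity: A Modern Approach*, CUP 2009, §1.3 (polynomial
  time: composition and bounded loops), §6.1 (descriptions).
* I. L. Markov, Y. Shi, SIAM J. Comput. 38 (2008), §1 Cor. 1.5 (the statement served).
-/

noncomputable section

namespace Literature.Computability.QuantumComplexity

open _root_.Computability Complexity Complexity.Brick Complexity.Plumb Cryptography

namespace LightCone

attribute [-simp] Brick.nthF_zero Brick.sndPow_zero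

variable {N : ℕ}

/-! ### Codes of entries and states -/

/-- **The code of an entry** `(y, a)`: `⟨List.ofFn y, ampEnc a⟩`. [folklore] -/
def itemEnc (p : QReg N × Amp) : List Bool := boolPair (List.ofFn p.1) (ampEnc p.2)

/-- **The code of a sparse state**: the coded list of the entry codes. [folklore] -/
def stEnc (st : List (QReg N × Amp)) : List Bool := encList (st.map itemEnc)

/-- The parts of an entry code. [folklore] -/
@[simp] theorem fstF_itemEnc (p : QReg N × Amp) : fstF (itemEnc p) = List.ofFn p.1 := fstF_boolPair _ _

/-- The parts of an entry code. [folklore] -/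
@[simp] theorem sndF_itemEnc (p : QReg N × Amp) : sndF (itemEnc p) = ampEnc p.2 := sndF_boolPair _ _

/-- The items of a state code. [folklore] -/
@[simp] theorem decNil_stEnc (st : List (QReg N × Amp)) : decNil (stEnc st) = st.map itemEnc := decNil_encList _

/-- The code of the empty state. [folklore] -/
@[simp] theorem stEnc_nil : stEnc ([] : List (QReg N × Amp)) = [] := rfl

/-- The code of a cons. [folklore] -/
theorem stEnc_cons (p : QReg N × Amp) (st : List (QReg N × Amp)) : stEnc (p :: st) = boolPair (itemEnc p) (stEnc st) := rfl

/-- The code of an append. [folklore] -/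
theorem stEnc_append (st st' : List (QReg N × Amp)) : stEnc (st ++ st') = stEnc st ++ stEnc st' := by
  rw [stEnc, stEnc, stEnc, List.map_append, Com.encList_eq_flatMap, Com.encList_eq_flatMap, Com.encList_eq_flatMap,
    List.flatMap_append]

/-- The code of a reversal has the same length. [folklore] -/
theorem length_stEnc_reverse (st : List (QReg N × Amp)) : (stEnc st.reverse).length = (stEnc st).length := by
  rw [stEnc, stEnc, length_encList, length_encList, List.map_reverse, List.map_reverse, List.sum_reverse]

/-- Length of an entry code. [folklore] -/
theorem length_itemEnc (p : QReg N × Amp) : (itemEnc p).length = 2 * N + 2 + (ampEnc p.2).length := by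
  rw [itemEnc, length_boolPair, List.length_ofFn]

/-- **Length of a state code with short entries**: `|stEnc st| ≤ #st · (2K + 2)` if every entry
code has at most `K` symbols. [folklore] -/
theorem length_stEnc_le {st : List (QReg N × Amp)} {K : ℕ} (h : ∀ p ∈ st, (itemEnc p).length ≤ K) :
    (stEnc st).length ≤ st.length * (2 * K + 2) := by
  induction st with
  | nil => simp [stEnc]
  | cons p st ih =>
    rw [stEnc_cons, length_boolPair, List.length_cons]
    have h1 := h p List.mem_cons_self
    have h2 := ih fun q hq => h q (List.mem_cons_of_mem p hq)
    nlinarith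

/-! ### Label bricks -/

/-- **The bit of the label `w z` at the unary position `|u z|`**, as a one-bit string function.
[folklore] -/
def bitF (u w : List Bool → List Bool) : List Bool → List Bool := ADH.bitT (bitAtFn ∘ pr u w)

/-- Value of `bitF` on every string. [folklore] -/
theorem bitF_apply (u w : List Bool → List Bool) (z : List Bool) :
    bitF u w z = [ADH.headBit (bitAtFn (boolPair (u z) (w z)))] := by
  simp [bitF]

/-- `bitF` is one-bit. [folklore] -/
theorem oneBit_bitF (u w : List Bool → List Bool) : OneBit (bitF u w) := fun z => ⟨_, bitF_apply u w z⟩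

/-- **`bitF` on a label**: with `u z = 1ⁱ` and `w z = List.ofFn y`, the bit `y i`. [folklore] -/
theorem bitF_label {u w : List Bool → List Bool} {z : List Bool} {y : QReg N} {i : Fin N}
    (hu : u z = ones i) (hw : w z = List.ofFn y) : bitF u w z = [y i] := by
  rw [bitF_apply, hu, hw, ADH.bitAtFn_label]; simp

/-- `bitF u w ∈ FP` for `u, w ∈ FP`. [folklore] -/
theorem bitF_mem_FP {u w : List Bool → List Bool} (hu : u ∈ FP) (hw : w ∈ FP) : bitF u w ∈ FP :=
  ADH.bitT_mem_FP (comp_mem_FP bitAtFn_mem_FP (fanoutFn_mem_FP hu hw))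

/-- **Writing the string `b z` at the unary position `|u z|` of the label `w z`**:
`w ↾ |u| ++ b ++ w ⇂ (|u| + 1)` (the `setF` of `ADHMachine.lean` with the label as a parameter).
[folklore] -/
def setF (u w b : List Bool → List Bool) : List Bool → List Bool :=
  OracleCompose.concatFn ∘ pr (takeFn ∘ pr u w)
    (OracleCompose.concatFn ∘ pr b (dropFn ∘ pr (List.cons true ∘ u) w))

/-- Value of `setF` on every string. [folklore] -/
theorem setF_apply (u w b : List Bool → List Bool) (z : List Bool) :
    setF u w b z = (w z).take (u z).length ++ b z ++ (w z).drop ((u z).length + 1) := by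
  simp [setF, List.append_assoc]

/-- **`setF` on a label**: with `u z = 1ⁱ`, `w z = List.ofFn y`, `b z = [c]`, the label `y[i ↦ c]`.
[folklore] -/
theorem setF_label {u w b : List Bool → List Bool} {z : List Bool} {y : QReg N} {i : Fin N} {c : Bool}
    (hu : u z = ones i) (hw : w z = List.ofFn y) (hb : b z = [c]) :
    setF u w b z = List.ofFn (Function.update y i c) := by
  rw [setF_apply, hu, hw, hb]
  simpa using ADH.set_label y i c

/-- `setF u w b ∈ FP`. [folklore] -/
theorem setF_mem_FP {u w b : List Bool → List Bool} (hu : u ∈ FP) (hw : w ∈ FP) (hb : b ∈ FP) : setF u w b ∈ FP :=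
  comp_mem_FP OracleCompose.concatFn_mem_FP (fanoutFn_mem_FP
    (comp_mem_FP takeFn_mem_FP (fanoutFn_mem_FP hu hw))
    (comp_mem_FP OracleCompose.concatFn_mem_FP (fanoutFn_mem_FP hb
      (comp_mem_FP dropFn_mem_FP (fanoutFn_mem_FP (comp_mem_FP (cons_mem_FP true) hu) hw)))))

/-- Total length of `setF`: `|setF u w b z| ≤ |w z| + |b z|`. [folklore] -/
theorem length_setF_le (u w b : List Bool → List Bool) (z : List Bool) :
    (setF u w b z).length ≤ (w z).length + (b z).length := by
  rw [setF_apply, List.length_append, List.length_append, List.length_take, List.length_drop]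
  omega

/-! ### Lookup -/

/-- **One step of the lookup fold** on `⟨⟨key, st⟩, ⟨entry, ⟨flag, val⟩⟩⟩`: once found (`flag ≠ ε`)
keep; otherwise, if the entry's label is the key, record `⟨1, its code⟩`, else keep. [folklore] -/
def lookStep : List Bool → List Bool :=
  iteFn (ADH.nilT (fstF ∘ sndPow 1))
    (iteFn (eqPairFn ∘ pr (fstF ∘ nthF 1) (fstF ∘ nthF 0)) (pr (fun _ => [true]) (sndF ∘ nthF 1)) (sndPow 1))
    (sndPow 1)

/-- **Lookup**: `⟨key, state⟩ ↦` the coordinate code stored for `key` (`ampEnc 0` if none).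
[folklore] -/
def lookupF : List Bool → List Bool := sndF ∘ foldFn lookStep (fun _ => boolPair [] zeroAmpC)

/-- `lookStep ∈ FP`. [folklore] -/
theorem lookStep_mem_FP : lookStep ∈ FP :=
  iteFn_mem_FP (ADH.nilT_mem_FP (comp_mem_FP fstF_mem_FP (sndPow_mem_FP 1)))
    (iteFn_mem_FP (comp_mem_FP eqPairFn_mem_FP (fanoutFn_mem_FP (comp_mem_FP fstF_mem_FP (nthF_mem_FP 1))
      (comp_mem_FP fstF_mem_FP (nthF_mem_FP 0)))) (fanoutFn_mem_FP (const_mem_FP _) (comp_mem_FP sndF_mem_FP (nthF_mem_FP 1)))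
      (sndPow_mem_FP 1))
    (sndPow_mem_FP 1)

/-- `lookStep` as an honest case distinction, on every string. [folklore] -/
theorem lookStep_eq (v : List Bool) :
    lookStep v = if fstF (sndPow 1 v) = [] then
      (if fstF (nthF 1 v) = fstF (nthF 0 v) then boolPair [true] (sndF (nthF 1 v)) else sndPow 1 v)
      else sndPow 1 v := by
  rw [lookStep, iteFn_apply (ADH.nilT_apply _ v)]
  by_cases h0 : fstF (sndPow 1 v) = []
  · simp only [Function.comp_apply, h0, decide_true, if_true]
    rw [iteFn_apply (b := decide (fstF (nthF 1 v) = fstF (nthF 0 v))) (by simp [eqPairFn_boolPair])]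
    by_cases h1 : fstF (nthF 1 v) = fstF (nthF 0 v) <;> simp [h1]
  · simp only [Function.comp_apply, h0, decide_false]
    simp

/-- `lookStep` on a record. [folklore] -/
theorem lookStep_record (w a flag val : List Bool) :
    lookStep (boolPair w (boolPair a (boolPair flag val))) =
      if flag = [] then (if fstF a = fstF w then boolPair [true] (sndF a) else boolPair flag val)
      else boolPair flag val := by
  rw [lookStep_eq]; simp [nthF, sndPow]

/-- **Growth of `lookStep`** (`FoldGrowth 4`): the output is the accumulator or `⟨1, part of the
entry⟩`. [folklore] -/
theorem foldGrowth_lookStep : FoldGrowth 4 lookStep := fun v => by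
  rw [lookStep_eq]
  have h1 : (sndPow 1 v).length = (sndF (sndF v)).length := by simp [sndPow]
  have h2 : (sndF (nthF 1 v)).length ≤ (fstF (sndF v)).length := by
    have := length_fstF_sndF_le (nthF 1 v); simp only [nthF, Function.comp_apply] at this ⊢; omega
  split_ifs
  · rw [length_boolPair]; simp only [List.length_singleton]; omega
  · omega
  · omega

/-- `lookupF ∈ FP`. [folklore] -/
theorem lookupF_mem_FP : lookupF ∈ FP :=
  comp_mem_FP sndF_mem_FP (foldFn_mem_FP lookStep_mem_FP (const_mem_FP _) foldGrowth_lookStep)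

/-- The lookup fold on entry codes, from a "not found" accumulator. [folklore] -/
theorem foldl_lookStep (y : QReg N) (w : List Bool) (hw : fstF w = List.ofFn y) (val : List Bool) :
    ∀ st : List (QReg N × Amp),
      (st.map itemEnc).foldl (fun acc a => lookStep (boolPair w (boolPair a acc))) (boolPair [] val) =
        if y ∈ st.map Prod.fst then boolPair [true] (ampEnc (lookup st y)) else boolPair [] val := by
  have found : ∀ (st : List (QReg N × Amp)) (v : List Bool),
      (st.map itemEnc).foldl (fun acc a => lookStep (boolPair w (boolPair a acc))) (boolPair [true] v) =
        boolPair [true] v := by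
    intro st
    induction st with
    | nil => intro v; rfl
    | cons p st ih => intro v; rw [List.map_cons, List.foldl_cons, lookStep_record]; simp [ih]
  intro st
  induction st with
  | nil => simp
  | cons p st ih =>
    rw [List.map_cons, List.foldl_cons, lookStep_record, if_pos rfl, fstF_itemEnc, hw]
    by_cases hp : p.1 = y
    · rw [if_pos (by rw [hp]), found, lookup_cons, if_pos hp, sndF_itemEnc]
      simp [hp]
    · rw [if_neg (fun h => hp (List.ofFn_injective h)), ih, lookup_cons, if_neg hp]
      have hiff : (y ∈ p.1 :: st.map Prod.fst) ↔ y ∈ st.map Prod.fst := by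
        rw [List.mem_cons]
        exact ⟨fun h => h.resolve_left (fun h' => hp h'.symm), Or.inr⟩
      simp only [List.map_cons, hiff]

/-- **`lookupF` computes `lookup`**: on `⟨List.ofFn y, stEnc st⟩` it returns `ampEnc (lookup st y)`.
[folklore] -/
theorem lookupF_stEnc (y : QReg N) (st : List (QReg N × Amp)) :
    lookupF (boolPair (List.ofFn y) (stEnc st)) = ampEnc (lookup st y) := by
  rw [lookupF, Function.comp_apply, foldFn_boolPair, decNil_stEnc,
    foldl_lookStep y _ (fstF_boolPair _ _) zeroAmpC st]
  by_cases hy : y ∈ st.map Prod.fst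
  · rw [if_pos hy, sndF_boolPair]
  · rw [if_neg hy, sndF_boolPair, lookup_eq_zero_of_not_mem hy]; rfl

/-- **Total length of a lookup**: `|lookupF w| ≤ |sndF w| + 20` on every string (the value is the
zero code or part of an item of the list). [folklore] -/
theorem length_lookupF_le (w : List Bool) : (lookupF w).length ≤ (sndF w).length + 20 := by
  rw [lookupF, Function.comp_apply, foldFn_apply]
  set L := sndF w
  have key : ∀ (items : List (List Bool)) (acc : List Bool), (∀ a ∈ items, 2 * a.length ≤ L.length) →
      (sndF acc).length ≤ L.length + 20 →
      (sndF (items.foldl (fun acc a => lookStep (boolPair w (boolPair a acc))) acc)).length ≤ L.length + 20 := by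
    intro items
    induction items with
    | nil => intro acc _ hacc; exact hacc
    | cons a items ih =>
      intro acc hitems hacc
      rw [List.foldl_cons]
      refine ih _ (fun b hb => hitems b (List.mem_cons_of_mem a hb)) ?_
      rw [lookStep_eq]
      simp only [nthF, sndPow, Function.comp_apply, fstF_boolPair, sndF_boolPair]
      split_ifs
      · rw [sndF_boolPair]
        have h1 := length_fstF_sndF_le a
        have h2 := hitems a List.mem_cons_self
        omega
      · exact hacc
      · exact hacc
  refine key (decNil L) _ (fun a ha => two_mul_length_le_of_mem_decNil ha) ?_
  rw [sndF_boolPair, length_zeroAmpC]; omega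


/-! ### Codes of wire lists and gate lists -/

/-- The code of a wire list: the coded list of the binary numerals. [folklore] -/
def sEnc (S : List (Fin N)) : List Bool := encList (S.map fun i : Fin N => encodeNat i.val)

/-- The code of a gate list: the coded list of the gate codes. [folklore] -/
def ccEnc (cc : List (QGate cliffordT N)) : List Bool := encList (cc.map QGate.encode)

/-- `sEnc` of a cons. [folklore] -/
theorem sEnc_cons (i : Fin N) (S : List (Fin N)) : sEnc (i :: S) = boolPair (encodeNat i.val) (sEnc S) := rfl

/-- `ccEnc` of a cons. [folklore] -/
theorem ccEnc_cons (g : QGate cliffordT N) (cc : List (QGate cliffordT N)) : ccEnc (g :: cc) = boolPair g.encode (ccEnc cc) := rfl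

/-- **Membership by value** in a coded wire list: `anyFn eqValFn ⟨bin i, sEnc S⟩ = [i ∈ S]`. [folklore] -/
theorem memVal_sEnc (i : Fin N) (S : List (Fin N)) :
    anyFn eqValFn (boolPair (encodeNat (i : ℕ)) (sEnc S)) = [decide (i ∈ S)] := by
  rw [anyFn_boolPair oneBit_eqValFn, sEnc, decNil_encList]
  have key : (∃ a ∈ S.map (fun k : Fin N => encodeNat k.val), eqValFn (boolPair (encodeNat (i : ℕ)) a) = [true]) ↔ i ∈ S := by
    constructor
    · rintro ⟨a, ha, h⟩
      obtain ⟨k, hk, rfl⟩ := List.mem_map.1 ha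
      rw [eqValFn_boolPair, bitsToNat_encodeNat, bitsToNat_encodeNat] at h
      simp only [List.cons.injEq, and_true, decide_eq_true_eq] at h
      rwa [Fin.ext h]
    · intro h
      exact ⟨_, List.mem_map.2 ⟨i, h, rfl⟩, by rw [eqValFn_boolPair]; simp⟩
  by_cases h : i ∈ S
  · rw [decide_eq_true (key.2 h), decide_eq_true h]
  · rw [decide_eq_false (fun h' => h (key.1 h')), decide_eq_false h]

/-! ### Reversing a coded list -/

/-- **Reversal** of the coded list `sndF w`: push its items. [folklore] -/
def revF : List Bool → List Bool := foldFn (pr (nthF 1) (sndPow 1)) (fun _ => [])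

/-- Pushing the items of a list onto a coded accumulator. [folklore] -/
theorem foldl_boolPair_encList (L M : List (List Bool)) :
    L.foldl (fun acc a => boolPair a acc) (encList M) = encList (L.reverse ++ M) := by
  induction L generalizing M with
  | nil => rfl
  | cons a L ih =>
    rw [List.foldl_cons, ← encList_cons, ih, List.reverse_cons, List.append_assoc, List.singleton_append]

/-- **`revF` reverses**: on `w` with `sndF w = encList L`, `encList L.reverse`. [folklore] -/
theorem revF_apply {w : List Bool} {L : List (List Bool)} (hw : sndF w = encList L) : revF w = encList L.reverse := by
  rw [revF, foldFn_apply, hw, decNil_encList]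
  have h := foldl_boolPair_encList L []
  rw [List.append_nil] at h
  simp only [pr_apply, nthF, sndPow, Function.comp_apply, fstF_boolPair, sndF_boolPair] at h ⊢
  exact h

/-- `revF ∈ FP` (`FoldGrowth 2`). [folklore] -/
theorem revF_mem_FP : revF ∈ FP := by
  refine foldFn_mem_FP (fanoutFn_mem_FP (nthF_mem_FP 1) (sndPow_mem_FP 1)) (const_mem_FP _) (c := 2) fun v => ?_
  rw [pr_apply, length_boolPair]
  simp only [nthF, sndPow, Function.comp_apply]
  omega

/-! ### Parsing a gate code -/

/-- The code of the next gate (the item of the fold). [folklore] -/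
abbrev aF : List Bool → List Bool := nthF 1
/-- The binary code of the gate symbol (`ε, 1, 01, 11` for `H, S, T, CNOT`). [folklore] -/
def opF : List Bool → List Bool := fstF ∘ List.tail ∘ aF
/-- The wire numbers `⟨bin i, ⟨bin j, ε⟩⟩`. [folklore] -/
def wsF : List Bool → List Bool := sndF ∘ sndF ∘ List.tail ∘ aF
/-- The first wire number, binary. [folklore] -/
def iF : List Bool → List Bool := fstF ∘ wsF
/-- The second wire number, binary (`ε` for one-qubit gates). [folklore] -/
def jF : List Bool → List Bool := fstF ∘ sndF ∘ wsF

/-- `opF ∈ FP`. [folklore] -/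
theorem opF_mem_FP : opF ∈ FP := comp_mem_FP fstF_mem_FP (comp_mem_FP PRelSigma.tail_mem_FP (nthF_mem_FP 1))
/-- `wsF ∈ FP`. [folklore] -/
theorem wsF_mem_FP : wsF ∈ FP :=
  comp_mem_FP sndF_mem_FP (comp_mem_FP sndF_mem_FP (comp_mem_FP PRelSigma.tail_mem_FP (nthF_mem_FP 1)))
/-- `iF ∈ FP`. [folklore] -/
theorem iF_mem_FP : iF ∈ FP := comp_mem_FP fstF_mem_FP wsF_mem_FP
/-- `jF ∈ FP`. [folklore] -/
theorem jF_mem_FP : jF ∈ FP := comp_mem_FP fstF_mem_FP (comp_mem_FP sndF_mem_FP wsF_mem_FP)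

/-- The wire numbers are short: `2|iF v| ≤ |aF v|` and `2|jF v| ≤ |aF v|`. [folklore] -/
theorem length_iF_jF_le (v : List Bool) : 2 * (iF v).length ≤ (aF v).length ∧ 2 * (jF v).length ≤ (aF v).length := by
  have h1 := length_fstF_sndF_le (List.tail (aF v))
  have h2 := length_fstF_sndF_le (sndF (List.tail (aF v)))
  have h3 := length_fstF_sndF_le (sndF (sndF (List.tail (aF v))))
  have h4 := length_fstF_sndF_le (sndF (sndF (sndF (List.tail (aF v)))))
  have h5 : (List.tail (aF v)).length ≤ (aF v).length := by simp
  simp only [iF, jF, wsF, Function.comp_apply]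
  omega

/-- The parsed pieces of a record whose item is `false ⟨op, ⟨ar, ⟨bi, rest⟩⟩⟩`. [folklore] -/
theorem pieces (w op ar bi rest acc : List Bool) :
    let v := boolPair w (boolPair (false :: boolPair op (boolPair ar (boolPair bi rest))) acc)
    opF v = op ∧ iF v = bi ∧ jF v = fstF rest ∧ aF v = (false :: boolPair op (boolPair ar (boolPair bi rest))) ∧
      sndPow 1 v = acc ∧ nthF 0 v = w := by
  simp [opF, iF, jF, wsF, nthF, sndPow]

/-! ### The cone pass -/

/-- The wire list `S` of the accumulator `⟨S, CC⟩`. [folklore] -/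
def cSF : List Bool → List Bool := fstF ∘ sndPow 1
/-- The kept codes `CC` of the accumulator. [folklore] -/
def cCF : List Bool → List Bool := sndF ∘ sndPow 1
/-- "wire `i` is in the cone". [folklore] -/
def tiT : List Bool → List Bool := anyFn eqValFn ∘ pr iF cSF
/-- "wire `j` is in the cone". [folklore] -/
def tjT : List Bool → List Bool := anyFn eqValFn ∘ pr jF cSF
/-- "the gate is a `CNOT`". [folklore] -/
def isCT : List Bool → List Bool := ADH.eqC [true, true] opF
/-- The new wire list. [folklore] -/
def newSF : List Bool → List Bool :=
  iteFn isCT (iteFn tiT (iteFn tjT cSF (pr jF cSF)) (iteFn tjT (pr iF cSF) cSF)) cSF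
/-- "the gate is kept". [folklore] -/
def touchedT : List Bool → List Bool := orFn tiT (andFn isCT tjT)
/-- The new kept codes. [folklore] -/
def newCF : List Bool → List Bool := iteFn touchedT (pr aF cCF) cCF

/-- **One step of the cone pass** on `⟨w, ⟨code, ⟨S, CC⟩⟩⟩` (the dispatch of `LightCone.coneStep`).
[folklore] -/
def coneStepF : List Bool → List Bool := pr newSF newCF

/-- **The cone pass**: fold `coneStepF` over the (reversed) code list `sndF w` from `⟨[bin 0], ε⟩`.
[folklore] -/
def conePassF : List Bool → List Bool := foldFn coneStepF (fun _ => boolPair (boolPair [] []) [])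

/-- `tiT ∈ FP`. [folklore] -/
theorem tiT_mem_FP : tiT ∈ FP :=
  comp_mem_FP (anyFn_mem_FP eqValFn_mem_FP oneBit_eqValFn) (fanoutFn_mem_FP iF_mem_FP (comp_mem_FP fstF_mem_FP (sndPow_mem_FP 1)))
/-- `tjT ∈ FP`. [folklore] -/
theorem tjT_mem_FP : tjT ∈ FP :=
  comp_mem_FP (anyFn_mem_FP eqValFn_mem_FP oneBit_eqValFn) (fanoutFn_mem_FP jF_mem_FP (comp_mem_FP fstF_mem_FP (sndPow_mem_FP 1)))
/-- `isCT ∈ FP`. [folklore] -/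
theorem isCT_mem_FP : isCT ∈ FP := ADH.eqC_mem_FP _ opF_mem_FP
/-- `newSF ∈ FP`. [folklore] -/
theorem newSF_mem_FP : newSF ∈ FP := by
  have hS : cSF ∈ FP := comp_mem_FP fstF_mem_FP (sndPow_mem_FP 1)
  exact iteFn_mem_FP isCT_mem_FP (iteFn_mem_FP tiT_mem_FP (iteFn_mem_FP tjT_mem_FP hS (fanoutFn_mem_FP jF_mem_FP hS))
    (iteFn_mem_FP tjT_mem_FP (fanoutFn_mem_FP iF_mem_FP hS) hS)) hS
/-- `touchedT ∈ FP`. [folklore] -/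
theorem touchedT_mem_FP : touchedT ∈ FP := orFn_mem_FP tiT_mem_FP (andFn_mem_FP isCT_mem_FP tjT_mem_FP)
/-- `newCF ∈ FP`. [folklore] -/
theorem newCF_mem_FP : newCF ∈ FP :=
  iteFn_mem_FP touchedT_mem_FP (fanoutFn_mem_FP (nthF_mem_FP 1) (comp_mem_FP sndF_mem_FP (sndPow_mem_FP 1)))
    (comp_mem_FP sndF_mem_FP (sndPow_mem_FP 1))
/-- `coneStepF ∈ FP`. [folklore] -/
theorem coneStepF_mem_FP : coneStepF ∈ FP := fanoutFn_mem_FP newSF_mem_FP newCF_mem_FP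

/-- `tiT` is one-bit. [folklore] -/
theorem oneBit_tiT : OneBit tiT := (oneBit_anyFn oneBit_eqValFn).comp _
/-- `tjT` is one-bit. [folklore] -/
theorem oneBit_tjT : OneBit tjT := (oneBit_anyFn oneBit_eqValFn).comp _
/-- `isCT` is one-bit. [folklore] -/
theorem oneBit_isCT : OneBit isCT := fun v => ⟨_, ADH.eqC_apply _ _ v⟩
/-- `touchedT` is one-bit. [folklore] -/
theorem oneBit_touchedT : OneBit touchedT := oneBit_orFn oneBit_tiT (oneBit_andFn oneBit_isCT oneBit_tjT)

/-- **Growth of the cone step** (`FoldGrowth 8`): `S` grows by at most one (short) wire numeral,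
`CC` by at most the code. [folklore] -/
theorem foldGrowth_coneStepF : FoldGrowth 8 coneStepF := fun v => by
  have hij := length_iF_jF_le v
  have hacc := length_fstF_sndF_le (sndPow 1 v)
  have hS : (newSF v).length ≤ (cSF v).length + (aF v).length + 2 := by
    simp only [newSF, iteFn_of_oneBit oneBit_isCT, iteFn_of_oneBit oneBit_tiT, iteFn_of_oneBit oneBit_tjT]
    split_ifs <;> simp only [fanoutFn_apply, length_boolPair, cSF, Function.comp_apply] <;> omega
  have hC : (newCF v).length ≤ (cCF v).length + 2 * (aF v).length + 2 := by
    simp only [newCF, iteFn_of_oneBit oneBit_touchedT]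
    split_ifs <;> simp only [fanoutFn_apply, length_boolPair, cCF, Function.comp_apply] <;> omega
  rw [coneStepF, pr_apply, length_boolPair]
  simp only [cSF, cCF, Function.comp_apply, sndPow, nthF] at hS hC hacc ⊢
  omega

/-- **`conePassF ∈ FP`.** [cite: AroraBarak2009, §1.3] -/
theorem conePassF_mem_FP : conePassF ∈ FP := foldFn_mem_FP coneStepF_mem_FP (const_mem_FP _) foldGrowth_coneStepF

/-! ### The cone pass computes `coneL` -/

section Spec

variable (w : List Bool) (S : List (Fin N)) (cc : List (QGate cliffordT N))

/-- The tests of the step on a record with a code `false ⟨op, ⟨ar, ⟨bin i, rest⟩⟩⟩`. [folklore] -/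
theorem tests_record (op ar rest : List Bool) (i : Fin N) :
    tiT (boolPair w (boolPair (false :: boolPair op (boolPair ar (boolPair (encodeNat (i : ℕ)) rest))) (boolPair (sEnc S) (ccEnc cc)))) =
        [decide (i ∈ S)] ∧
      isCT (boolPair w (boolPair (false :: boolPair op (boolPair ar (boolPair (encodeNat (i : ℕ)) rest))) (boolPair (sEnc S) (ccEnc cc)))) =
        [decide (op = [true, true])] ∧
      cSF (boolPair w (boolPair (false :: boolPair op (boolPair ar (boolPair (encodeNat (i : ℕ)) rest))) (boolPair (sEnc S) (ccEnc cc)))) =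
        sEnc S ∧
      cCF (boolPair w (boolPair (false :: boolPair op (boolPair ar (boolPair (encodeNat (i : ℕ)) rest))) (boolPair (sEnc S) (ccEnc cc)))) =
        ccEnc cc := by
  obtain ⟨hop, hi, -, -, -, -⟩ := pieces w op ar (encodeNat (i : ℕ)) rest (boolPair (sEnc S) (ccEnc cc))
  have hS : cSF (boolPair w (boolPair (false :: boolPair op (boolPair ar (boolPair (encodeNat (i : ℕ)) rest)))
      (boolPair (sEnc S) (ccEnc cc)))) = sEnc S := by simp [cSF, sndPow]
  have hC : cCF (boolPair w (boolPair (false :: boolPair op (boolPair ar (boolPair (encodeNat (i : ℕ)) rest)))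
      (boolPair (sEnc S) (ccEnc cc)))) = ccEnc cc := by simp [cCF, sndPow]
  refine ⟨?_, ?_, hS, hC⟩
  · simp only [tiT, Function.comp_apply, pr_apply, hi, hS]; exact memVal_sEnc i S
  · simp only [isCT, ADH.eqC_apply, hop]

/-- **The step on a one-qubit gate code**: `S` is unchanged, the code is kept iff its wire is in
`S`. [folklore] -/
theorem coneStepF_one (op ar : List Bool) (hop : op ≠ [true, true]) (i : Fin N) :
    coneStepF (boolPair w (boolPair (false :: boolPair op (boolPair ar (boolPair (encodeNat (i : ℕ)) [])))
      (boolPair (sEnc S) (ccEnc cc)))) =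
      boolPair (sEnc S) (if i ∈ S then boolPair (false :: boolPair op (boolPair ar (boolPair (encodeNat (i : ℕ)) []))) (ccEnc cc)
        else ccEnc cc) := by
  obtain ⟨hti, hisC, hS, hC⟩ := tests_record w S cc op ar [] i
  obtain ⟨-, -, -, ha, -, -⟩ := pieces w op ar (encodeNat (i : ℕ)) [] (boolPair (sEnc S) (ccEnc cc))
  have hisC' : isCT (boolPair w (boolPair (false :: boolPair op (boolPair ar (boolPair (encodeNat (i : ℕ)) [])))
      (boolPair (sEnc S) (ccEnc cc)))) = [false] := hisC.trans (by simp [hop])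
  obtain ⟨bj, hbj⟩ := oneBit_tjT (boolPair w (boolPair (false :: boolPair op (boolPair ar (boolPair (encodeNat (i : ℕ)) [])))
      (boolPair (sEnc S) (ccEnc cc))))
  rw [coneStepF, pr_apply, newSF, iteFn_apply hisC', newCF, touchedT,
    iteFn_apply (orFn_apply hti (andFn_apply hisC' hbj))]
  simp only [Bool.false_eq_true, if_false, hS, Bool.false_and, Bool.or_false, pr_apply, ha, hC]
  by_cases h : i ∈ S <;> simp [h]

/-- **The step on a `CNOT` code.** [folklore] -/
theorem coneStepF_CNOT (i j : Fin N) :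
    coneStepF (boolPair w (boolPair (false :: boolPair [true, true] (boolPair [true, true]
      (boolPair (encodeNat (i : ℕ)) (boolPair (encodeNat (j : ℕ)) [])))) (boolPair (sEnc S) (ccEnc cc)))) =
      boolPair (if i ∈ S then (if j ∈ S then sEnc S else sEnc (j :: S)) else (if j ∈ S then sEnc (i :: S) else sEnc S))
        (if (i ∈ S ∨ j ∈ S) then boolPair (false :: boolPair [true, true] (boolPair [true, true]
          (boolPair (encodeNat (i : ℕ)) (boolPair (encodeNat (j : ℕ)) [])))) (ccEnc cc) else ccEnc cc) := by
  obtain ⟨hti, hisC, hS, hC⟩ := tests_record w S cc [true, true] [true, true] (boolPair (encodeNat (j : ℕ)) []) i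
  obtain ⟨-, hi, hj, ha, -, -⟩ := pieces w [true, true] [true, true] (encodeNat (i : ℕ)) (boolPair (encodeNat (j : ℕ)) [])
    (boolPair (sEnc S) (ccEnc cc))
  rw [fstF_boolPair] at hj
  have hisC' : isCT (boolPair w (boolPair (false :: boolPair [true, true] (boolPair [true, true]
      (boolPair (encodeNat (i : ℕ)) (boolPair (encodeNat (j : ℕ)) [])))) (boolPair (sEnc S) (ccEnc cc)))) = [true] :=
    hisC.trans (by simp)
  have htj : tjT (boolPair w (boolPair (false :: boolPair [true, true] (boolPair [true, true]
      (boolPair (encodeNat (i : ℕ)) (boolPair (encodeNat (j : ℕ)) [])))) (boolPair (sEnc S) (ccEnc cc)))) = [decide (j ∈ S)] := by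
    simp only [tjT, Function.comp_apply, pr_apply, hj, hS]; exact memVal_sEnc j S
  rw [coneStepF, pr_apply, newSF, iteFn_apply hisC', newCF, touchedT,
    iteFn_apply (orFn_apply hti (andFn_apply hisC' htj))]
  simp only [if_true, iteFn_apply hti, iteFn_apply htj, pr_apply, hi, hj, hS, hC, ha, Bool.true_and,
    sEnc_cons]
  by_cases h1 : i ∈ S <;> by_cases h2 : j ∈ S <;> simp [h1, h2]

/-- The code of the result of a cone step. [folklore] -/
def pairEnc (p : List (Fin N) × List (QGate cliffordT N)) : List Bool := boolPair (sEnc p.1) (ccEnc p.2)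

/-- **One step of the pass is `coneStep`** on an oracle-free gate. [folklore] -/
theorem coneStepF_encode (g : QGate cliffordT N) (hg : g.IsOracleFree) :
    coneStepF (boolPair w (boolPair g.encode (pairEnc (S, cc)))) = pairEnc (coneStep g (S, cc)) := by
  cases g with
  | oracle k e => exact absurd hg id
  | gate op e =>
    cases op with
    | H =>
      rw [ADH.encode_gateH, pairEnc, coneStepF_one w S cc [] [true] (by simp) (embH e 0)]
      simp only [coneStep]; split_ifs <;> simp [pairEnc, ccEnc_cons, ADH.encode_gateH]
    | S =>
      rw [ADH.encode_gateS, pairEnc, coneStepF_one w S cc [true] [true] (by simp) (embS e 0)]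
      simp only [coneStep]; split_ifs <;> simp [pairEnc, ccEnc_cons, ADH.encode_gateS]
    | T =>
      rw [ADH.encode_gateT, pairEnc, coneStepF_one w S cc [false, true] [true] (by simp) (embT e 0)]
      simp only [coneStep]; split_ifs <;> simp [pairEnc, ccEnc_cons, ADH.encode_gateT]
    | CNOT =>
      rw [ADH.encode_gateCNOT, pairEnc, coneStepF_CNOT w S cc (embC e 0) (embC e 1)]
      simp only [coneStep]
      by_cases h1 : embC e 0 ∈ S <;> by_cases h2 : embC e 1 ∈ S <;>
        simp [h1, h2, pairEnc, ccEnc_cons, ADH.encode_gateCNOT]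

end Spec

/-- **The cone pass computes `coneL`**: on `w` with `sndF w = encList` of the reversed gate codes of
an oracle-free list `gs`, `conePassF w` is the code of `coneL gs [0]`. [folklore] -/
theorem conePassF_spec (hN : 0 < N) {w : List Bool} {gs : List (QGate cliffordT N)}
    (hfree : ∀ g ∈ gs, g.IsOracleFree) (hw : sndF w = encList (gs.map QGate.encode).reverse) :
    conePassF w = pairEnc (coneL gs [⟨0, hN⟩]) := by
  rw [conePassF, foldFn_apply, hw, decNil_encList, List.foldl_reverse, List.foldr_map]
  have h0 : boolPair (boolPair [] []) [] = pairEnc (([⟨0, hN⟩] : List (Fin N)), ([] : List (QGate cliffordT N))) := by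
    simp [pairEnc, sEnc, ccEnc, encList_cons, show encodeNat 0 = [] by decide]
  rw [h0]
  clear hw h0
  induction gs with
  | nil => rfl
  | cons g gs ih =>
    rw [List.foldr_cons, ih (fun g' hg' => hfree g' (List.mem_cons_of_mem g hg')), coneL_cons]
    obtain ⟨S, cc⟩ := coneL gs [⟨0, hN⟩]
    exact coneStepF_encode w S cc g (hfree g List.mem_cons_self)

/-! ### The Hadamard count -/

/-- "the item is the code of an `H` gate" (gate-symbol code `ε`). [folklore] -/
def isHT : List Bool → List Bool := ADH.nilT opF

/-- **The unary Hadamard count** of the coded gate list `sndF w`. [folklore] -/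
def hCountF : List Bool → List Bool := foldFn (iteFn isHT (List.cons true ∘ sndPow 1) (sndPow 1)) (fun _ => [])

/-- `hCountF ∈ FP` (`FoldGrowth 1`). [folklore] -/
theorem hCountF_mem_FP : hCountF ∈ FP := by
  refine foldFn_mem_FP (iteFn_mem_FP (ADH.nilT_mem_FP opF_mem_FP) (comp_mem_FP (cons_mem_FP true) (sndPow_mem_FP 1))
    (sndPow_mem_FP 1)) (const_mem_FP _) (c := 1) fun v => ?_
  rw [iteFn_of_oneBit (c := isHT) (oneBit_isNilFn.comp opF)]
  split_ifs <;> simp [sndPow] <;> omega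

/-- The count step on a gate code. [folklore] -/
theorem hStep_encode (w acc : List Bool) (g : QGate cliffordT N) (hg : g.IsOracleFree) :
    iteFn isHT (List.cons true ∘ sndPow 1) (sndPow 1) (boolPair w (boolPair g.encode acc)) =
      if QGateIsH g then true :: acc else acc := by
  have key : ∀ (op ar bi rest : List Bool),
      iteFn isHT (List.cons true ∘ sndPow 1) (sndPow 1) (boolPair w (boolPair (false :: boolPair op (boolPair ar (boolPair bi rest))) acc)) =
        if op = [] then true :: acc else acc := by
    intro op ar bi rest
    obtain ⟨hop, -, -, -, hacc, -⟩ := pieces w op ar bi rest acc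
    rw [isHT, iteFn_apply (ADH.nilT_apply opF _), hop]
    by_cases h : op = [] <;> simp [h, hacc]
  cases g with
  | oracle k e => exact absurd hg id
  | gate op e =>
    cases op with
    | H => rw [ADH.encode_gateH, key]; rfl
    | S => rw [ADH.encode_gateS, key]; rfl
    | T => rw [ADH.encode_gateT, key]; rfl
    | CNOT => rw [ADH.encode_gateCNOT, key]; rfl

/-- **`hCountF` counts the Hadamard gates**: on `w` with `sndF w = ccEnc cc` (oracle-free),
`1^{hCount cc}`. [folklore] -/
theorem hCountF_ccEnc {w : List Bool} {cc : List (QGate cliffordT N)} (hfree : ∀ g ∈ cc, g.IsOracleFree)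
    (hw : sndF w = ccEnc cc) : hCountF w = ones (hCount cc) := by
  rw [hCountF, foldFn_apply, hw, ccEnc, decNil_encList]
  suffices h : ∀ (k : ℕ), (cc.map QGate.encode).foldl
      (fun acc a => iteFn isHT (List.cons true ∘ sndPow 1) (sndPow 1) (boolPair w (boolPair a acc))) (ones k) =
      ones (k + hCount cc) by simpa using h 0
  clear hw
  induction cc with
  | nil => intro k; simp
  | cons g cc ih =>
    intro k
    rw [List.map_cons, List.foldl_cons, hStep_encode w _ g (hfree g List.mem_cons_self), hCount_cons]
    by_cases hH : QGateIsH g = true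
    · rw [if_pos hH, show true :: ones k = ones (k + 1) by simp [ones, List.replicate_succ],
        ih (fun g' hg' => hfree g' (List.mem_cons_of_mem g hg'))]
      simp [hH]; ring_nf
    · rw [if_neg hH, ih (fun g' hg' => hfree g' (List.mem_cons_of_mem g hg'))]
      simp [hH]

end LightCone

end Literature.Computability.QuantumComplexity

end
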